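import Summits.BirchSwinnertonDyer.BirchSwinnertonDyer.Theorems.SchneiderFreeAdditiveX3BranchIntDivOfExistsFrame
import Summits.BirchSwinnertonDyer.BirchSwinnertonDyer.Theorems.SchneiderFreeAdditiveX3LogOmegaConjugatePrime
import Summits.BirchSwinnertonDyer.BirchSwinnertonDyer.Theorems.SchneiderFreeAdditiveX3GordTwoBranchIMCOfKY
import HarnessLib

/-!
# Route `SchneiderFreeAdditiveX3` (K1 door), cruxes r2 / r3: the ♭-road socket with the frame at the CONJUGATE prime —
# `Ch_Λ(X_ac^∅ strict at 𝔭) · 𝓞_{ℂ_p}⟦T⟧ ⊆ (Q)` for a ♭-frame `Q` of `f_E` at `(ι′, 𝔭̄)`, i.e. Keller–Yin's convention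

Cell `bsd-schneider-ideate`, seat `bsd-schneider-door-c5` (prover, generation 19; assembly layer).  PARTITION: board row
B6 ∩ X3 ∩ sst-twist, `r = 1`, of `Rank1Residual.partition`; types-the-object-of nothing new; closes none of B6's cells.
bears_on: K1-door (route-BirchSwinnertonDyer-SchneiderFreeAdditiveX3 items 19176 / 19177; FINDING-door-c5-g19 §2).

WHY THIS VARIANT.  bsd-potss-kmc's ♭-socket (p546778; Poitou–Tate-free form p631992) asks the divisibility H3♭ for frames of
`Dt.f` at `(ι′, 𝔭)` against `X_ac^∅` STRICT AT THE SAME `𝔭`.  Keller–Yin's Theorem 3.5.1 (typed `thm351_charIdeal_eq_branch_OPEN`)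
is stated in the OTHER convention: the branch `𝓛_v` lives at the prime `v` induced by the embedding datum while the Selmer group
`𝔛` is strict at `v̄` (`PotOrdSetting ι W K v v̄ κ N`; the door's H3 docstring: «the tree's shape with `𝔭 = v̄`»).  A MATCHED
Keller–Yin frame (FINDING-door-c5-g19 §2: (M1) = `rankinSelbergValueHecke_genusTwist_eq`, LANDED p633239; (M2) = the local form
of the `p`-adic avatar at `v ∣ p`, not in the tree) therefore delivers the divisibility for a frame at the CONJUGATE prime `𝔭̄`
against `X_ac^∅` strict at `𝔭`.  The socket does not care: it only reads `ord_p` of constant terms, and in rank one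
`(log_{ω,𝔭̄} P)² = (log_{ω,𝔭} P)²` (door-c5 g8 `sq_logOmega_embAt_eq_of_rank_one`: `σ_* P = ±P + torsion`).  So this file
re-runs kmc's proof with Hsieh's frame and Liu–Zhang–Zhang's value taken at `(ι′, 𝔭̄)` (`exists_conjugate_degreeOne`,
door-c3 g7) and the logarithm moved back to `𝔭`:

* §1 `additiveIMCLowerBDPInputManinAt_of_kolyvagin_of_hsieh_of_lzz_of_intDivConj` — the socket on a pair of the cell from
  Kolyvagin, Hsieh 2014 Thm A (any level), LZZ 2018 (additive) and H3♭ᶜ: for every degree-one `𝔭̄ ≠ 𝔭` above `p`, every `ι′`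
  inducing `𝔭̄` and every ♭-frame `Q` of `Dt.f` at `(ι′, 𝔭̄)`: `Ch_Λ(X_ac^∅ at 𝔭)·𝓞_{ℂ_p}⟦T⟧ ⊆ (Q)`.
* §2 the two cruxes BY NAME from H3♭ᶜ on their cells (`…_of_intDivConj`), and from its ∃-frame form (`…_of_exists_intDivConj`,
  x11b3's ideal rigidity via `ideal_le_span_of_exists_frame`, p633598) — the exact output shape of «KY3-branch + CHx + MATCH».

HONEST FRAMING: THEOREMS ONLY (no definition, no named fact, no `sorry`); pure composition of tree theorems; CONDITIONAL on the
displayed hypotheses (on (M) no divisibility is in print; on (G-ord) Keller–Yin is a PREPRINT and the matching is not in the tree);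
nothing is closed; BSD is proved for no curve; «closes rung: none».
References: [JetchevSkinnerWan2017] §7.4.1; [Hsieh2014] Thm. A; [LiuZhangZhang2018] Thm 1.5.1/1.5.3; [Castella2018] Thm. 3.1;
[KellerYin2024b] arXiv:2410.23241 Def. 3.4.1, Thm. 3.5.1 (preprint; conventions); [SilvermanAEC2009] VIII.6.7, IV.6.4.
-/

set_option autoImplicit false
-- `Summit.<P>.<Sub>` repeats `BirchSwinnertonDyer` by the tree's layout convention (D-0017)
set_option linter.dupNamespace false

noncomputable section

open scoped Classical NumberField

open Field NumberField IsDedekindDomain WeierstrassCurve PowerSeries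
  Literature.NumberTheory.EllipticCurves Literature.NumberTheory.EllipticCurves.GreenbergSelmer
  Literature.NumberTheory.GaloisRepresentations Literature.NumberTheory.GaloisCohomology
  Literature.NumberTheory.EllipticCurves.ModularForms Literature.NumberTheory.EllipticCurves.Rank1Residual
  Summit.BirchSwinnertonDyer.Rank1Residual Summit.BirchSwinnertonDyer.Rank1Residual.X11b
  Summit.BirchSwinnertonDyer.Rank1Residual.X11b.AcSelmer Summit.BirchSwinnertonDyer.Rank1Residual.X11b.Halves
  Summit.BirchSwinnertonDyer.Rank1Residual.X11b.CongruenceLimit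
  Summit.BirchSwinnertonDyer.BirchSwinnertonDyer.Theorems.SchneiderFree
  Summit.BirchSwinnertonDyer.BirchSwinnertonDyer.Theses.SchneiderFreeAdditiveX3

namespace Summit.BirchSwinnertonDyer.BirchSwinnertonDyer.Theorems.SchneiderFreeAdditiveX3.ControlDischarged

/-! ### §1 The socket with the ♭-frame at the conjugate prime -/

/-- **The additive LOWER socket from Kolyvagin, Hsieh (any level), LZZ (additive) and the ♭-divisibility AT THE CONJUGATE PRIME.**
On a pair of the cell (`p ≠ 2`, `ClassX3 W p`, `SubSemistableTwist W p`): for every datum and frame `(κ, γ, 𝔭)` — CTL₀ gives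
`Ch_Λ(X_ac^∅ at 𝔭) = (f)`, `ord_p f(0) = n` (Poitou–Tate (i) is the tree theorem `pt_selmer_forall`); the conjugate degree-one prime
`𝔭̄` and an embedding datum `ι′` inducing it; Hsieh gives a ♭-frame `Q` of `Dt.f` at `(ι′, 𝔭̄)`; LZZ pins `Q(0) = u·(log_{𝔭̄} P / c)²`,
`‖u‖ = 1`; rank one (Kolyvagin) gives `(log_{𝔭̄} P)² = (log_𝔭 P)²`; the displayed divisibility H3♭ᶜ puts `f` in `(Q)`; norms give
`2·ord_p log_𝔭 P ≤ n + 2·v_p(c)`.  CONDITIONAL on `hKo`, `hA`, `hL`, `hDiv`; nothing asserted about any curve.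
[cite: JetchevSkinnerWan2017, §7.4.1 (arXiv:1512.06894 p. 30)] [cite: Hsieh2014, Thm. A p. 712 (Doc. Math. 19)]
[cite: LiuZhangZhang2018, Thm 1.5.1 and Thm 1.5.3 (Duke Math. J. 167 pp. 748–749)] [cite: SilvermanAEC2009, VIII.6.7 and IV.6.4] -/
theorem additiveIMCLowerBDPInputManinAt_of_kolyvagin_of_hsieh_of_lzz_of_intDivConj
    (hKo : ∀ (N : ℕ) [NeZero N] (W : WeierstrassCurve ℚ) (K : Type) [Field K] [NumberField K],
      Literature.NumberTheory.EllipticCurves.kolyvagin N W K)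
    (hA : Hsieh2014.thmA_exists_isHsiehLFunction_unrPeriod_anyLevel)
    (hL : LiuZhangZhang2018.thm151_thm153_modularCurve_heegnerVector_additive)
    {W : WeierstrassCurve ℚ} [W.IsElliptic] [W.IsGloballyMinimal] {p : ℕ} [Fact p.Prime]
    (hp2 : p ≠ 2) (hX : ClassX3 W p) (hS : Additive.SubSemistableTwist W p)
    (hDiv : ∀ (N : ℕ) [NeZero N] (K : Type) [Field K] [NumberField K]
      (Dt : ModularParametrizationData W N) (H : HeegnerDatum N (NumberField.discr K)) (ι : K →+* ℂ)
      (P : (W.baseChange K).toAffine.Point),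
      W.analyticRank = 1 → Additive.N10.Locus W p → W.conductorNorm ℤ = N → IsImaginaryQuadratic K →
      Odd (NumberField.discr K) → ¬ p ∣ Units.torsionOrder K → SatisfiesHeegnerHypothesis N K →
      (W.quadraticTwist (NumberField.discr K : ℚ)).entireLFunction 1 ≠ 0 →
      WeierstrassCurve.Affine.Point.map ι.toRatAlgHom P = heegnerPointComplex Dt H →
      ¬ IsOfFinAddOrder P →
      ∀ (κ : ZpExtension K p), κ.IsAnticyclotomic →
        ∀ (γ : Field.absoluteGaloisGroup K) [Fact (κ.IsTopGenerator γ)]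
          (𝔭 : HeightOneSpectrum (𝓞 K)), ((p : ℕ) : 𝓞 K) ∈ 𝔭.asIdeal →
          𝔭.asIdeal.ramificationIdx (𝓞 ℚ) = 1 → 𝔭.asIdeal.inertiaDeg (𝓞 ℚ) = 1 →
          ∀ (𝔮 : HeightOneSpectrum (𝓞 K)), ((p : ℕ) : 𝓞 K) ∈ 𝔮.asIdeal → 𝔭 ≠ 𝔮 →
            𝔮.asIdeal.ramificationIdx (𝓞 ℚ) = 1 → 𝔮.asIdeal.inertiaDeg (𝓞 ℚ) = 1 →
            ∀ (ι' : PadicAlgCl p ≃+* ℂ), BranchInducesPrime p ι' 𝔮 →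
              ∀ (ΩK : ℂ) (Ωp : ℂ_[p]) (Q : PowerSeries (PadicComplexInt p)), ΩK ≠ 0 → Ωp ≠ 0 →
                R1.IsBDPLFunctionInt p ι' 𝔮 κ γ Dt.f ΩK Ωp Q →
                  (XAc.charIdeal (W.baseChange K) p κ 𝔭 ∅ γ).map (PowerSeries.map (R1.toCpInt p)) ≤
                    Ideal.span {Q}) :
    AdditiveIMCLowerBDPInputManinAt W p := by
  intro N _ K _ _ Dt H ι P hr' hloc hN hK hodd hunit hHe hL1 hP hnt κ hκ γ _ 𝔭 h𝔭 he hf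
  have hp : p.Prime := Fact.out
  have hγ : κ.IsTopGenerator γ := Fact.out
  -- CTL₀ at `𝔭`: the characteristic ideal is principal with `ord_p f(0) = n`
  obtain ⟨n, hn⟩ := exists_hasCharValuationAt_of_pt_of_kolyvagin pt_selmer_forall hKo W p hr' hp2 hX hS N K Dt H ι P
    hr' hloc hN hK hodd hunit hHe hL1 hP hnt κ hκ γ 𝔭 h𝔭 he hf
  -- `p² ∣ N`
  have haddv : Addv W p := hloc.2.1
  have hp2N : p ^ 2 ∣ N := by
    by_contra h
    rw [← hN] at h
    rcases hasGoodReductionAtPrime_or_hasMultiplicativeReductionAtPrime_of_not_sq_dvd_conductorNorm (V := W) h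
      with hg | hm
    · exact haddv.1 hg
    · exact haddv.2 hm
  have hpN : p ∣ N := dvd_trans (dvd_pow_self p two_ne_zero) hp2N
  have hsplit : ((Ideal.span {(p : ℤ)}).primesOver (𝓞 K)).ncard = 2 := hHe p hp hpN
  -- the conjugate degree-one prime `𝔮 = 𝔭̄`, an embedding datum inducing it, Hsieh's frame there
  obtain ⟨𝔮, h𝔮, hne, he', hf'⟩ := exists_conjugate_degreeOne hK.1 h𝔭 he hf
  obtain ⟨ι₀⟩ := PadicAlgCl.nonempty_ringEquiv_complex p
  obtain ⟨ι', -, hι'⟩ := exists_datum_forall_mem_iff p ι₀ hK h𝔮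
  obtain ⟨lam, rlam, hlu, hinfl, hAQ, hunrl, havl, hfacl⟩ := lambdaSupplyAt hp2 ι' K κ hK hκ
  subst hN
  -- rank one over `K` (Kolyvagin), for the `𝔭 ↔ 𝔭̄` symmetry of `log_ω P`
  have hrk : (W.baseChange K).mordellWeilRank = 1 := (hKo _ W K hK hHe ⟨Dt, H, ι, hP⟩ hnt).1
  obtain ⟨A, ΩK₀, C, Ωp, Q₀, hA0, hΩK₀, hC, hQ₀⟩ :=
    hA ι' K 𝔮 κ γ Dt.f lam rlam hp2 Dt.isNewformOf.1 hK hsplit h𝔮 hι' hHe hlu hinfl hAQ hunrl havl hfacl hκ hγ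
  obtain ⟨ΩK, c, hΩK, -, hQ⟩ :=
    exists_isBDPLFunctionInt_of_isHsiehLFunction ι' 𝔮 κ γ Dt.f hpN hA0 hΩK₀ hC ((Ωp : unrIntegers p) : ℂ_[p]) hQ₀
  have hΩp : ((Ωp : unrIntegers p) : ℂ_[p]) ≠ 0 := fun h0 ↦ by
    have h1 := norm_coe_units_unrIntegers p Ωp
    rw [h0, norm_zero] at h1
    exact zero_ne_one h1
  set Q : PowerSeries (PadicComplexInt p) := PowerSeries.C c * Q₀ with hQdef
  -- the value of the frame at `𝟙` (LZZ at `𝔭̄`, `‖u‖ = 1`), its logarithm moved to `𝔭`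
  obtain ⟨u, hu, hval'⟩ :=
    UniversalToricDescentWaldspurgerFlat.intSeries_value_of_frame_tors hL W K 𝔮 κ γ Dt H ι P Dt.f Dt.isNewformOf
      hp2 rfl hp2N hK hunit h𝔮 he' hf' hHe hκ hP hnt ι' hι' hΩK hΩp hQ
  set x : ℚ_[p] := logOmega W p (embAt K p 𝔭 h𝔭 he hf) P / (Dt.c : ℚ_[p]) with hx
  have hval : IntSeries.HasValueAt Q 0 (u * (algebraMap ℚ_[p] ℂ_[p] x) ^ 2) := by
    have hsq := sq_logOmega_embAt_eq_of_rank_one W p hK.1 hrk h𝔭 he hf h𝔮 he' hf' P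
    have hx2 : (logOmega W p (embAt K p 𝔮 h𝔮 he' hf') P / (Dt.c : ℚ_[p])) ^ 2 = x ^ 2 := by
      rw [hx, div_pow, div_pow, hsq]
    rw [← map_pow, ← hx2, map_pow]
    exact hval'
  -- the ♭-divisibility at this frame
  have hdiv := hDiv (W.conductorNorm ℤ) K Dt H ι P hr' hloc rfl hK hodd hunit hHe hL1 hP hnt κ hκ γ 𝔭 h𝔭 he hf
    𝔮 h𝔮 hne he' hf' ι' hι' ΩK _ Q hΩK hΩp hQ
  -- the lower norm half over `𝓞_{ℂ_p}⟦T⟧` (verbatim kmc)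
  obtain ⟨htors, f, hfI, hf0, hfn⟩ := hn
  have hmem : PowerSeries.map (R1.toCpInt p) f ∈ Ideal.span {Q} := by
    have h3 := hdiv
    rw [hfI, map_span_singleton_powerSeries] at h3
    exact (Ideal.span_singleton_le_iff_mem _).mp h3
  have hQ0 : u * (algebraMap ℚ_[p] ℂ_[p] x) ^ 2 = ((constantCoeff Q : PadicComplexInt p) : ℂ_[p]) :=
    R1.intSeries_eq_constantCoeff_of_hasValueAt_zero p hval
  obtain ⟨G, hG⟩ := Ideal.mem_span_singleton'.mp hmem
  have hfac : algebraMap ℚ_[p] ℂ_[p] ((constantCoeff f : ℤ_[p]) : ℚ_[p]) =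
      ((constantCoeff G : PadicComplexInt p) : ℂ_[p]) * ((constantCoeff Q : PadicComplexInt p) : ℂ_[p]) := by
    rw [← R1.coe_toCpInt, ← constantCoeff_map_apply (R1.toCpInt p) f, ← hG, map_mul, MulMemClass.coe_mul]
  have hp1 : (1 : ℝ) < p := by exact_mod_cast hp.one_lt
  have hnormf : ‖((constantCoeff f : ℤ_[p]) : ℚ_[p])‖ ≤ ‖x‖ ^ 2 := by
    calc ‖((constantCoeff f : ℤ_[p]) : ℚ_[p])‖
        = ‖algebraMap ℚ_[p] ℂ_[p] ((constantCoeff f : ℤ_[p]) : ℚ_[p])‖ := (norm_algebraMap' ℂ_[p] _).symm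
      _ = ‖((constantCoeff G : PadicComplexInt p) : ℂ_[p])‖ * ‖((constantCoeff Q : PadicComplexInt p) : ℂ_[p])‖ := by
          rw [hfac, norm_mul]
      _ ≤ 1 * ‖((constantCoeff Q : PadicComplexInt p) : ℂ_[p])‖ :=
          mul_le_mul_of_nonneg_right (R1.norm_coe_padicComplexInt_le_one p _) (norm_nonneg _)
      _ = ‖u‖ * ‖algebraMap ℚ_[p] ℂ_[p] x‖ ^ 2 := by rw [one_mul, ← hQ0, norm_mul, norm_pow]
      _ = ‖x‖ ^ 2 := by rw [hu, one_mul, norm_algebraMap']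
  -- `x ≠ 0`
  have hlog : logOmega W p (embAt K p 𝔭 h𝔭 he hf) P ≠ 0 := R1.logOmega_ne_zero W p _ hnt
  have hc0 : Dt.c ≠ 0 := Dt.maninConstant_ne_zero_holds
  have hc0' : (Dt.c : ℚ_[p]) ≠ 0 := by exact_mod_cast hc0
  have hx0 : x ≠ 0 := div_ne_zero hlog hc0'
  -- norms to valuations: `2·ord_p x ≤ ord_p f(0) = n`
  rw [← PadicInt.norm_def, PadicInt.norm_eq_zpow_neg_valuation hf0, Padic.norm_eq_zpow_neg_valuation hx0] at hnormf
  have hrhs : ((p : ℝ) ^ (-x.valuation)) ^ 2 = (p : ℝ) ^ (-(2 * x.valuation)) := by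
    rw [← zpow_natCast ((p : ℝ) ^ (-x.valuation)) 2, ← zpow_mul]
    congr 1
    push_cast
    ring
  rw [hrhs, zpow_le_zpow_iff_right₀ hp1] at hnormf
  have hle : 2 * x.valuation ≤ ((constantCoeff f).valuation : ℤ) := by omega
  rw [hx, div_eq_mul_inv, Padic.valuation_mul hlog (inv_ne_zero hc0'), Padic.valuation_inv,
    Padic.valuation_intCast, valuation_logOmega hlog, hfn] at hle
  refine ⟨n, ⟨htors, f, hfI, hf0, hfn⟩, ?_⟩
  simp only [padicValInt] at hle
  linarith

/-! ### §2 The two branch cruxes from H3♭ᶜ (∀-frame and ∃-frame forms) -/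

/-- **Crux r2 `PotMultBranchIMC` (item 19176) ⇐ Kolyvagin ∧ Hsieh 2014 Thm. A (any level) ∧ Liu–Zhang–Zhang 2018 (additive) ∧
H3♭ᶜ∃ on the (M) cell**: ONE ♭-frame of `Dt.f` at the conjugate prime `(ι′, 𝔭̄)` per datum with `Ch_Λ(X_ac^∅ at 𝔭)·𝓞_{ℂ_p}⟦T⟧ ⊆
(Q₀)` (x11b3 rigidity carries it to every frame; then §1).  CONDITIONAL; on (M) no divisibility is in print.
[cite: Hsieh2014, Thm. A p. 712 (Doc. Math. 19)] [cite: LiuZhangZhang2018, Thm 1.5.1 and Thm 1.5.3 (Duke Math. J. 167 pp. 748–749)]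
[cite: Castella2018, Thm. 3.1 (arXiv:1704.06608 p. 9)] -/
theorem potMultBranchIMC_of_kolyvagin_of_hsieh_of_lzz_of_exists_intDivConj
    (hKo : ∀ (N : ℕ) [NeZero N] (W : WeierstrassCurve ℚ) (K : Type) [Field K] [NumberField K],
      Literature.NumberTheory.EllipticCurves.kolyvagin N W K)
    (hA : Hsieh2014.thmA_exists_isHsiehLFunction_unrPeriod_anyLevel)
    (hL : LiuZhangZhang2018.thm151_thm153_modularCurve_heegnerVector_additive)
    (hM : ∀ (W : WeierstrassCurve ℚ) [W.IsElliptic] [W.IsGloballyMinimal] (p : ℕ) [Fact p.Prime],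
      W.analyticRank = 1 → p ≠ 2 → ClassX3 W p → Additive.SubM W p →
      ∀ (N : ℕ) [NeZero N] (K : Type) [Field K] [NumberField K]
        (Dt : ModularParametrizationData W N) (H : HeegnerDatum N (NumberField.discr K)) (ι : K →+* ℂ)
        (P : (W.baseChange K).toAffine.Point),
        W.analyticRank = 1 → Additive.N10.Locus W p → W.conductorNorm ℤ = N → IsImaginaryQuadratic K →
        Odd (NumberField.discr K) → ¬ p ∣ Units.torsionOrder K → SatisfiesHeegnerHypothesis N K →
        (W.quadraticTwist (NumberField.discr K : ℚ)).entireLFunction 1 ≠ 0 →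
        WeierstrassCurve.Affine.Point.map ι.toRatAlgHom P = heegnerPointComplex Dt H →
        ¬ IsOfFinAddOrder P →
        ∀ (κ : ZpExtension K p), κ.IsAnticyclotomic →
          ∀ (γ : Field.absoluteGaloisGroup K) [Fact (κ.IsTopGenerator γ)]
            (𝔭 : HeightOneSpectrum (𝓞 K)), ((p : ℕ) : 𝓞 K) ∈ 𝔭.asIdeal →
            𝔭.asIdeal.ramificationIdx (𝓞 ℚ) = 1 → 𝔭.asIdeal.inertiaDeg (𝓞 ℚ) = 1 →
            ∀ (𝔮 : HeightOneSpectrum (𝓞 K)), ((p : ℕ) : 𝓞 K) ∈ 𝔮.asIdeal → 𝔭 ≠ 𝔮 →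
              𝔮.asIdeal.ramificationIdx (𝓞 ℚ) = 1 → 𝔮.asIdeal.inertiaDeg (𝓞 ℚ) = 1 →
              ∀ (ι' : PadicAlgCl p ≃+* ℂ), BranchInducesPrime p ι' 𝔮 →
                ∃ (ΩK : ℂ) (Ωp : ℂ_[p]) (Q : PowerSeries (PadicComplexInt p)), ΩK ≠ 0 ∧ Ωp ≠ 0 ∧
                  R1.IsBDPLFunctionInt p ι' 𝔮 κ γ Dt.f ΩK Ωp Q ∧
                    (XAc.charIdeal (W.baseChange K) p κ 𝔭 ∅ γ).map (PowerSeries.map (R1.toCpInt p)) ≤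
                      Ideal.span {Q}) :
    PotMultBranchIMC := by
  intro W _ _ p _ hr hp2 hX hSM
  refine additiveIMCLowerBDPInputManinAt_of_kolyvagin_of_hsieh_of_lzz_of_intDivConj hKo hA hL hp2 hX (Or.inl hSM) ?_
  intro N _ K _ _ Dt H ι P hr' hloc hN hK hodd hunit hHe hL1 hP hnt κ hκ γ hγ 𝔭 h𝔭 he hf 𝔮 h𝔮 hne he' hf' ι' hι'
    ΩK Ωp Q hΩK hΩp hQ
  exact ideal_le_span_of_exists_frame hp2 hK hκ hγ.out
    (hM W p hr hp2 hX hSM N K Dt H ι P hr' hloc hN hK hodd hunit hHe hL1 hP hnt κ hκ γ 𝔭 h𝔭 he hf 𝔮 h𝔮 hne he' hf' ι' hι')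
    hΩK hΩp hQ

/-- **Crux r3 `GordTwoBranchIMC` (item 19177) ⇐ Kolyvagin ∧ Hsieh 2014 Thm. A (any level) ∧ Liu–Zhang–Zhang 2018 (additive) ∧
H3♭ᶜ∃ on the (G-ord, `e = 2`) cell**: ONE ♭-frame of `Dt.f` at the conjugate prime `(ι′, 𝔭̄)` per datum with
`Ch_Λ(X_ac^∅ at 𝔭)·𝓞_{ℂ_p}⟦T⟧ ⊆ (Q₀)` — EXACTLY what Keller–Yin Thm. 3.5.1 in branch currency (`thm351_charIdeal_eq_branch_OPEN`,
`v = 𝔭̄`, `v̄ = 𝔭`) delivers at a matched frame (matching = (M1) p633239 + (M2), FINDING-door-c5-g19 §2).  CONDITIONAL; Keller–Yin is a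
PREPRINT, the matching is not in the tree. [cite: KellerYin2024b, Def. 3.4.1 and Thm. 3.5.1 (arXiv:2410.23241 pp. 19–20) (preprint; conventions)]
[cite: Hsieh2014, Thm. A p. 712 (Doc. Math. 19)] [cite: LiuZhangZhang2018, Thm 1.5.1 and Thm 1.5.3 (Duke Math. J. 167 pp. 748–749)] -/
theorem gordTwoBranchIMC_of_kolyvagin_of_hsieh_of_lzz_of_exists_intDivConj
    (hKo : ∀ (N : ℕ) [NeZero N] (W : WeierstrassCurve ℚ) (K : Type) [Field K] [NumberField K],
      Literature.NumberTheory.EllipticCurves.kolyvagin N W K)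
    (hA : Hsieh2014.thmA_exists_isHsiehLFunction_unrPeriod_anyLevel)
    (hL : LiuZhangZhang2018.thm151_thm153_modularCurve_heegnerVector_additive)
    (hG : ∀ (W : WeierstrassCurve ℚ) [W.IsElliptic] [W.IsGloballyMinimal] (p : ℕ) [Fact p.Prime],
      W.analyticRank = 1 → p ≠ 2 → ClassX3 W p → Additive.SubGordTwo W p →
      ∀ (N : ℕ) [NeZero N] (K : Type) [Field K] [NumberField K]
        (Dt : ModularParametrizationData W N) (H : HeegnerDatum N (NumberField.discr K)) (ι : K →+* ℂ)
        (P : (W.baseChange K).toAffine.Point),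
        W.analyticRank = 1 → Additive.N10.Locus W p → W.conductorNorm ℤ = N → IsImaginaryQuadratic K →
        Odd (NumberField.discr K) → ¬ p ∣ Units.torsionOrder K → SatisfiesHeegnerHypothesis N K →
        (W.quadraticTwist (NumberField.discr K : ℚ)).entireLFunction 1 ≠ 0 →
        WeierstrassCurve.Affine.Point.map ι.toRatAlgHom P = heegnerPointComplex Dt H →
        ¬ IsOfFinAddOrder P →
        ∀ (κ : ZpExtension K p), κ.IsAnticyclotomic →
          ∀ (γ : Field.absoluteGaloisGroup K) [Fact (κ.IsTopGenerator γ)]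
            (𝔭 : HeightOneSpectrum (𝓞 K)), ((p : ℕ) : 𝓞 K) ∈ 𝔭.asIdeal →
            𝔭.asIdeal.ramificationIdx (𝓞 ℚ) = 1 → 𝔭.asIdeal.inertiaDeg (𝓞 ℚ) = 1 →
            ∀ (𝔮 : HeightOneSpectrum (𝓞 K)), ((p : ℕ) : 𝓞 K) ∈ 𝔮.asIdeal → 𝔭 ≠ 𝔮 →
              𝔮.asIdeal.ramificationIdx (𝓞 ℚ) = 1 → 𝔮.asIdeal.inertiaDeg (𝓞 ℚ) = 1 →
              ∀ (ι' : PadicAlgCl p ≃+* ℂ), BranchInducesPrime p ι' 𝔮 →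
                ∃ (ΩK : ℂ) (Ωp : ℂ_[p]) (Q : PowerSeries (PadicComplexInt p)), ΩK ≠ 0 ∧ Ωp ≠ 0 ∧
                  R1.IsBDPLFunctionInt p ι' 𝔮 κ γ Dt.f ΩK Ωp Q ∧
                    (XAc.charIdeal (W.baseChange K) p κ 𝔭 ∅ γ).map (PowerSeries.map (R1.toCpInt p)) ≤
                      Ideal.span {Q}) :
    GordTwoBranchIMC := by
  intro W _ _ p _ hr hp2 hX hSG
  refine additiveIMCLowerBDPInputManinAt_of_kolyvagin_of_hsieh_of_lzz_of_intDivConj hKo hA hL hp2 hX (Or.inr hSG) ?_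
  intro N _ K _ _ Dt H ι P hr' hloc hN hK hodd hunit hHe hL1 hP hnt κ hκ γ hγ 𝔭 h𝔭 he hf 𝔮 h𝔮 hne he' hf' ι' hι'
    ΩK Ωp Q hΩK hΩp hQ
  exact ideal_le_span_of_exists_frame hp2 hK hκ hγ.out
    (hG W p hr hp2 hX hSG N K Dt H ι P hr' hloc hN hK hodd hunit hHe hL1 hP hnt κ hκ γ 𝔭 h𝔭 he hf 𝔮 h𝔮 hne he' hf' ι' hι')
    hΩK hΩp hQ

end Summit.BirchSwinnertonDyer.BirchSwinnertonDyer.Theorems.SchneiderFreeAdditiveX3.ControlDischarged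

end
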